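import Literature.Geometry.Riemannian.AlmostNonnegRicciFibration
import Literature.Geometry.MetricGeometry.Submetry
import Literature.Geometry.MetricGeometry.ProductIsometrySplitting
import HarnessLib

/-!
# Huang–Huang–Wang–Zhu 2026, Main Theorem 1 — proofs file (elementary layers)

Sibling of `Literature/Geometry/Riemannian/AlmostNonnegRicciFibration.lean`, which vendors the
named fact `huangHuangWangZhu2026_fibresOverCircle_four` = H. Huang, X.-T. Huang, J. Wang, X. Zhu,
*Fibrations, the First Betti Number, and Almost Nonnegative Ricci Curvature*, arXiv:2605.24380
(2026), **Main Theorem 1** (p. 3) at `n = 4`, `b₁ = 1`.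

STATUS OF THE DISCHARGE. `huangHuangWangZhu2026_fibresOverCircle_four_holds` is NOT proved here.
The printed proof (§4, pp. 13–14) argues by contradiction along a sequence `Mᵢ` with
`Ric ≥ -εᵢ → 0`, `sec ≥ -1`, `diam ≤ 1`, and rests on: (1) the equivariant pointed
Gromov–Hausdorff limit `(M̂ᵢ, Hᵢ) → (ℝˢ × Ŷ, H)` of the free-abelian covers (Cheeger–Colding
splitting of Ricci limits, Fukaya–Yamaguchi equivariant precompactness, the paper's Lemma on local
abelian actions); (2) the paper's Theorem 1.11 (an equivariant "regular" almost submetry on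
`RCD(-1,n)` spaces, proved in its §6 by centre-of-mass techniques); (3) Huang–Huang 2024,
Cor. 7.2 (non-degeneracy of `dF` under the generalized Reifenberg condition implied by
`sec ≥ -1`) and Ehresmann's lemma. None of this vocabulary (pointed/equivariant GH limits, `RCD`
spaces, normal covers with deck group `H₁/torsion`, `b₁`, splitting maps) exists in Mathlib or in
`Literature/` at present, so the fact stays a cited named hypothesis (see the statement file).

WHAT IS PROVED. The three elementary layers that the printed proof quotes without proof, in the
metric/normed-space generality in which they are used there:

§1. TRANSLATIONS (p. 13: "We recall a classical theorem which says that every element of an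
Abelian, cocompact subgroup of `Isom(ℝⁿ)` acts as a translation on `ℝⁿ`"; Thurston 1997,
Prop. 4.2.4 for discrete cocompact abelian groups). We prove the slightly more general statement
the paper needs (the group `G = Π₁(H)` there need not be discrete): a self-isometry `g` of a real
normed space whose displacement `x ↦ dist (g x) x` is bounded is a translation
(`isometryEquiv_exists_eq_add_of_dist_le`, via Mazur–Ulam `IsometryEquiv.toRealAffineIsometryEquiv`:
`g = L + g 0` with `L` a linear isometry, and `t ↦ ‖t (L u - u) + g 0‖` is unbounded unless
`L u = u`); the displacement of `g` is bounded as soon as the orbit of one point under isometries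
commuting with `g` is `D`-dense (`isometryEquiv_exists_eq_add_of_commute_of_dense`), in particular
for every element of an abelian subgroup of `Isom(V)` with a `D`-dense orbit
(`exists_eq_add_of_mem_of_comm_of_dense`).

§2. SHORT GENERATORS (p. 13: "Since `diam(Mᵢ) ≤ 1`, by a standard argument, `Hᵢ` is generated by
`Hᵢ(3)`", where `H(r) = {h ∈ H | d(hp, p) < r}` (§2.1, p. 6); the standard argument is Gromov's,
cf. Petersen, *Riemannian Geometry*, Ch. "Ricci curvature comparison", Lemma (Gromov 1980):
`π₁(M)` is generated by elements with `d(x, γx) ≤ 2 diam M`). Abstract form proved here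
(`subgroupClosure_setOf_dist_smul_lt_eq_top`): if a group `G` acts isometrically on a preconnected
pseudometric space `X` and the orbit of `p` is `D`-dense, then for every `ε > 0` the set
`{g | dist (g • p) p < 2D + ε}` generates `G`. The proof runs the clopen-equivalence-class argument
(`PreconnectedSpace.induction₂'`) on the relation "`a⁻¹b` lies in the generated subgroup whenever
`a • p` is `D`-close to `x` and `b • p` is `D`-close to `y`".

§3. ALMOST SUBMETRIES (p. 5): the paper's notion of a `δ`-almost submetry at scale `r₀`
(`IsAlmostSubmetry`, the hypothesis (i) of its Theorem 1.11), and the two facts called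
"elementary" there: a `δ/2`-Gromov–Hausdorff approximation (distortion `≤ δ/2`, `δ/2`-dense
image) is a `δ`-almost submetry at every scale (`isAlmostSubmetry_of_ghApprox`), and a `δ`-almost
submetry at scale `r₀ > δ > 0` onto a preconnected space is `δ`-almost onto
(`IsAlmostSubmetry.exists_dist_lt`); plus monotonicity in `(δ, r₀)`.

§4. LATTICE SELECTION (p. 13: "We take a discrete subgroup `G₀` of `G` such that the flat torus
`Tˢ := ℝˢ/G₀` satisfies `1 ≤ diam(Tˢ) ≤ 4n`, and `inj_{Tˢ} ≥ 1`", for the group `G` of translations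
with `diam(ℝˢ/G) ≤ 1`, `s ≤ n`). Proved here (`exists_lattice_of_dense_addSubgroup`): an additive
subgroup `A` of `ℝˢ = EuclideanSpace ℝ (Fin s)` with `1`-dense orbit of `0` contains `s` linearly
independent vectors `v₁, …, vₛ` (chosen `1`-close to `(√s + 2) eᵢ`) whose `ℤ`-span `Λ` has all
nonzero vectors of norm `≥ 2` (so `inj(ℝˢ/Λ) ≥ 1`), covering radius `≤ 2s ≤ 4n` (round the
coordinates: `‖∑ yᵢvᵢ‖ ≤ (2√s+2)‖y‖` and `‖y - round y‖ ≤ √s/2`), and `≥ 1` (the point `v₁/2` is at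
distance `≥ 1` from `Λ`), together with the two-sided comparison `2‖y‖ ≤ ‖∑ yᵢvᵢ‖ ≤ (2√s+2)‖y‖`
from which everything follows (`‖∑ yᵢ(vᵢ - c eᵢ)‖ ≤ ∑|yᵢ| ≤ √s ‖y‖`, Cauchy–Schwarz).

§5. SUBMETRIES VS ALMOST SUBMETRIES (p. 13: "`F` is a submetry at scale `1/4`"; p. 14: "Since
`Fᵢ` converges uniformly to `F` and `F` is a submetry at scale `1/4`, `Fᵢ` is a `εᵢ`-submetry at scale
`1/4` (`εᵢ ↓ 0`)"). With the submetry vocabulary of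
`Literature/Geometry/MetricGeometry/Submetry.lean` (`IsSubmetryAtScale`): a submetry at scale `r₀`
is a `δ`-almost submetry at scale `r₀` for every `δ > 0`
(`IsSubmetryAtScale.isAlmostSubmetry`), and the fixed-space form of the quoted stability statement:
if `F` is a submetry at scale `r₀` and `F'` is uniformly `η`-close to `F`, then `F'` is a `δ`-almost
submetry at scale `r₀ - η` for every `δ > 0` with `2η ≤ δ`
(`IsSubmetryAtScale.isAlmostSubmetry_of_dist_le`). (In the paper `Fᵢ` and `F` live on
Gromov–Hausdorff-close but different spaces; transporting along the approximations is the part that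
needs the equivariant GH vocabulary.)

§6. BRIDGE TO MATHLIB'S GROMOV–HAUSDORFF DISTANCE: an `ε`-GH approximation between nonempty
compact metric spaces (the convention of §3) gives `GromovHausdorff.ghDist X Y ≤ 3ε/2`
(`ghDist_le_of_ghApprox`, from Mathlib's `ghDist_le_of_approx_subsets`).

§7. THE LATTICE SUBGROUP `H₀ ≤ H`, THE TORUS `Tˢ` AND `X̄` (the second half of p. 13 assembled,
with `Literature/Geometry/MetricGeometry/ProductIsometrySplitting.lean` providing "`H` acts
separately on the two factors", `Π₁`, and the submetry of orbit spaces): for an ABELIAN subgroup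
`H ≤ Isom(ℝˢ ×₂ Ŷ)` (`Ŷ` nonempty bounded metric) with `1`-cobounded action — the output of the
limiting argument, taken as input — every `Π₁(h)` is a translation, and there is `H₀ ≤ H`
(generated by lifts of a good lattice of translation vectors chosen by §4) with `Π₁(H₀)` = the
translations by that lattice (`exists_latticeSubgroup`); hence `Tˢ = ℝˢ/Π₁(H₀)` has `inj ≥ 1`,
`1 ≤ diam Tˢ ≤ 2s (≤ 4n)`, `diam X̄ ≤ √((2s)² + D²)` for `X̄ = (ℝˢ ×₂ Ŷ)/H₀`, and `F : X̄ → Tˢ` is a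
submetry (`torusPackage`).

No new named facts are introduced (D-0026); everything below is proved.

## References

* H. Huang, X.-T. Huang, J. Wang, X. Zhu, arXiv:2605.24380 (2026), §1 p. 5, §2.1 p. 6, §4 pp. 13–14.
  [HuangHuangWangZhu2026]
* W. P. Thurston, *Three-Dimensional Geometry and Topology*, Vol. 1 (1997), Prop. 4.2.4. [Thurston1997]
* P. Petersen, *Riemannian Geometry*, Ch. "Ricci curvature comparison", §"Finiteness of fundamental
  groups", Lemma (M. Gromov, 1980). [Petersen2006]
-/

open Metric Set
open scoped Topology

namespace Literature.Geometry.Riemannian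

/-! ### §1. Isometries with bounded displacement are translations -/

section Translations

variable {V : Type*} [NormedAddCommGroup V] [NormedSpace ℝ V]

/-- Mazur–Ulam in the form used below: a self-isometry `g` of a real normed space is affine,
`g x = L x + g 0` with `L = (g.toRealAffineIsometryEquiv).linearIsometryEquiv` its linear part
(Mathlib's `IsometryEquiv.toRealAffineIsometryEquiv`). [folklore] -/
theorem isometryEquiv_apply_eq_linear_add (g : V ≃ᵢ V) (x : V) :
    g x = g.toRealAffineIsometryEquiv.linearIsometryEquiv x + g 0 := by
  have h := g.toRealAffineIsometryEquiv.map_vsub x 0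
  simp only [IsometryEquiv.coeFn_toRealAffineIsometryEquiv, vsub_eq_sub, sub_zero] at h
  rw [h, sub_add_cancel]

/-- An isometry of a real normed space with BOUNDED DISPLACEMENT is a translation: if
`dist (g x) x ≤ C` for all `x` then `g = (· + v)` for some `v` (namely `v = g 0`). Proof: by
Mazur–Ulam `g = L + g 0` with `L` a linear isometry; if `L u ≠ u` then the displacement at `t • u`
is `‖t • (L u - u) + g 0‖ ≥ |t| ‖L u - u‖ - ‖g 0‖`, unbounded in `t`. This is the mechanism behind
"abelian cocompact groups of Euclidean isometries act by translations" (Thurston 1997,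
Prop. 4.2.4; Huang–Huang–Wang–Zhu 2026, §4, p. 13). [folklore] -/
theorem isometryEquiv_exists_eq_add_of_dist_le (g : V ≃ᵢ V) {C : ℝ}
    (hC : ∀ x : V, dist (g x) x ≤ C) : ∃ v : V, ∀ x : V, g x = x + v := by
  set L := g.toRealAffineIsometryEquiv.linearIsometryEquiv with hL
  have hrepr : ∀ x, g x = L x + g 0 := isometryEquiv_apply_eq_linear_add g
  suffices hfix : ∀ u : V, L u = u by
    exact ⟨g 0, fun x ↦ by rw [hrepr x, hfix x]⟩
  intro u
  by_contra hu
  set w : V := L u - u with hw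
  have hw0 : w ≠ 0 := sub_ne_zero.mpr hu
  have hwpos : 0 < ‖w‖ := norm_pos_iff.mpr hw0
  have hdisp : ∀ t : ℝ, dist (g (t • u)) (t • u) = ‖t • w + g 0‖ := by
    intro t
    rw [dist_eq_norm, hrepr, LinearIsometryEquiv.map_smul, hw, smul_sub]
    congr 1
    abel
  have hC0 : 0 ≤ C := dist_nonneg.trans (hC 0)
  set t : ℝ := (C + ‖g 0‖ + 1) / ‖w‖ with ht
  have htpos : 0 < t := div_pos (by positivity) hwpos
  have h1 : ‖t • w‖ = C + ‖g 0‖ + 1 := by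
    rw [norm_smul, Real.norm_eq_abs, abs_of_pos htpos, ht, div_mul_cancel₀ _ hwpos.ne']
  have h3 : ‖t • w‖ ≤ ‖t • w + g 0‖ + ‖g 0‖ := by
    calc ‖t • w‖ = ‖(t • w + g 0) - g 0‖ := by rw [add_sub_cancel_right]
      _ ≤ ‖t • w + g 0‖ + ‖g 0‖ := norm_sub_le _ _
  have key := hC (t • u)
  rw [hdisp] at key
  linarith

/-- The form used in Huang–Huang–Wang–Zhu 2026, §4, p. 13 ("every element of an Abelian, cocompact
subgroup of `Isom(ℝⁿ)` acts as a translation"), without any discreteness assumption: if `g` is a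
self-isometry of a real normed space `V` and the orbit `{h x₀ | h ∈ S}` of one point under a set `S`
of isometries COMMUTING with `g` is `D`-dense in `V`, then `g` is a translation. Indeed the
displacement `x ↦ dist (g x) x` is invariant under isometries commuting with `g` and `2`-Lipschitz,
hence bounded by `dist (g x₀) x₀ + 2D`, and `isometryEquiv_exists_eq_add_of_dist_le` applies.
Thurston 1997, Prop. 4.2.4 is the discrete cocompact case.
[cite: HuangHuangWangZhu2026, §4 p. 13 (classical theorem on abelian cocompact subgroups of Isom(ℝⁿ))] -/
theorem isometryEquiv_exists_eq_add_of_commute_of_dense (g : V ≃ᵢ V) (S : Set (V ≃ᵢ V))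
    (hcomm : ∀ h ∈ S, ∀ x : V, g (h x) = h (g x)) (x₀ : V) {D : ℝ}
    (hD : ∀ x : V, ∃ h ∈ S, dist (h x₀) x ≤ D) :
    ∃ v : V, ∀ x : V, g x = x + v := by
  refine isometryEquiv_exists_eq_add_of_dist_le g (C := dist (g x₀) x₀ + 2 * D) fun x ↦ ?_
  obtain ⟨h, hS, hx⟩ := hD x
  have hx' : dist x (h x₀) ≤ D := by rwa [dist_comm]
  calc dist (g x) x ≤ dist (g x) (g (h x₀)) + dist (g (h x₀)) (h x₀) + dist (h x₀) x :=
        dist_triangle4 _ _ _ _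
    _ = dist x (h x₀) + dist (h (g x₀)) (h x₀) + dist (h x₀) x := by
        rw [g.dist_eq, hcomm h hS]
    _ = dist x (h x₀) + dist (g x₀) x₀ + dist (h x₀) x := by
        rw [h.dist_eq]
    _ ≤ dist (g x₀) x₀ + 2 * D := by linarith

/-- Every element of an ABELIAN subgroup `Γ` of the isometry group of a real normed space `V` with
a `D`-dense orbit `Γ x₀` (e.g. `Γ` cocompact) is a translation — the "classical theorem" invoked in
Huang–Huang–Wang–Zhu 2026, §4, p. 13 for `G = Π₁(H) ≤ Isom(ℝˢ)` (which need not be discrete);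
for discrete cocompact `Γ` this is Thurston 1997, Prop. 4.2.4 (`𝔼_A = 𝔼ⁿ`).
[cite: Thurston1997, Prop. 4.2.4] -/
theorem exists_eq_add_of_mem_of_comm_of_dense (Γ : Subgroup (V ≃ᵢ V))
    (hcomm : ∀ g ∈ Γ, ∀ h ∈ Γ, g * h = h * g) (x₀ : V) {D : ℝ}
    (hD : ∀ x : V, ∃ h ∈ Γ, dist (h x₀) x ≤ D) {g : V ≃ᵢ V} (hg : g ∈ Γ) :
    ∃ v : V, ∀ x : V, g x = x + v :=
  isometryEquiv_exists_eq_add_of_commute_of_dense g Γ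
    (fun h hh x ↦ by
      have := congrArg (fun e : V ≃ᵢ V ↦ e x) (hcomm g hg h hh)
      simpa [IsometryEquiv.mul_apply] using this) x₀ hD

end Translations

/-! ### §2. Cocompact isometric actions are generated by short elements -/

section ShortGenerators

variable {G X : Type*} [Group G] [PseudoMetricSpace X] [MulAction G X] [IsIsometricSMul G X]

/-- GENERATION BY SHORT ELEMENTS (Huang–Huang–Wang–Zhu 2026, §4, p. 13: "since `diam(Mᵢ) ≤ 1`, by a
standard argument, `Hᵢ` is generated by `Hᵢ(3)`", with `H(r) = {h ∈ H | d(hp,p) < r}`, §2.1 p. 6;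
Gromov 1980, cf. Petersen, *Riemannian Geometry*, "Finiteness of fundamental groups", Lemma
(Gromov): generators with `d(x, γx) ≤ 2 diam M`). Abstract form: a group `G` acting by isometries
on a PRECONNECTED pseudometric space `X` such that the orbit of `p` is `D`-dense
(`∀ x, ∃ g, dist (g • p) x ≤ D`, e.g. `diam(X/G) ≤ D` with attained infima) is generated, for every
`ε > 0`, by `{g | dist (g • p) p < 2D + ε}`. Proof: the relation
`P x y :⇔ ∀ a b, dist (a • p) x ≤ D → dist (b • p) y ≤ D → a⁻¹b ∈ ⟨S⟩` holds when `dist x y < ε`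
(then `dist (b • p) (a • p) < 2D + ε`), is transitive through a group element `D`-close to the
middle point, hence holds everywhere by connectedness (`PreconnectedSpace.induction₂'`); apply it to
`x = p`, `y = g • p`, `a = 1`, `b = g`. (In the paper: `X = M̂ᵢ` connected, `D = diam Mᵢ ≤ 1`,
`ε = 1`.) [cite: HuangHuangWangZhu2026, §4 p. 13 and §2.1 p. 6] -/
theorem subgroupClosure_setOf_dist_smul_lt_eq_top [PreconnectedSpace X] (p : X) {D ε : ℝ}
    (hε : 0 < ε) (hD : ∀ x : X, ∃ g : G, dist (g • p) x ≤ D) :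
    Subgroup.closure {g : G | dist (g • p) p < 2 * D + ε} = ⊤ := by
  set H := Subgroup.closure {g : G | dist (g • p) p < 2 * D + ε} with hH
  have hD0 : 0 ≤ D := by
    obtain ⟨g, hg⟩ := hD p
    exact dist_nonneg.trans hg
  -- one step of the chain: `a⁻¹ b` is a short element when `a • p`, `b • p` shadow `ε`-close points
  have hkey : ∀ (a b : G) (x y : X), dist (a • p) x ≤ D → dist (b • p) y ≤ D → dist x y < ε →
      a⁻¹ * b ∈ H := by
    intro a b x y ha hb hxy
    apply Subgroup.subset_closure
    have hrw : dist ((a⁻¹ * b) • p) p = dist (b • p) (a • p) := by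
      rw [← dist_smul a ((a⁻¹ * b) • p) p, smul_smul, mul_inv_cancel_left]
    have ha' : dist x (a • p) ≤ D := by rwa [dist_comm]
    have hxy' : dist y x < ε := by rwa [dist_comm]
    show dist ((a⁻¹ * b) • p) p < 2 * D + ε
    rw [hrw]
    calc dist (b • p) (a • p) ≤ dist (b • p) y + dist y x + dist x (a • p) := dist_triangle4 _ _ _ _
      _ < D + ε + D := by linarith
      _ = 2 * D + ε := by ring
  let P : X → X → Prop := fun x y ↦
    ∀ a b : G, dist (a • p) x ≤ D → dist (b • p) y ≤ D → a⁻¹ * b ∈ H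
  have hP : ∀ x y : X, P x y := by
    intro x y
    apply PreconnectedSpace.induction₂' P
    · intro z
      filter_upwards [Metric.ball_mem_nhds z hε] with w hw
      rw [Metric.mem_ball] at hw
      exact ⟨fun a b ha hb ↦ hkey a b z w ha hb (by rwa [dist_comm]),
        fun a b ha hb ↦ hkey a b w z ha hb hw⟩
    · refine ⟨fun x' y' z' hxy hyz a c ha hc ↦ ?_⟩
      obtain ⟨b, hb⟩ := hD y'
      have h1 : a⁻¹ * b ∈ H := hxy a b ha hb
      have h2 : b⁻¹ * c ∈ H := hyz b c hb hc
      have h3 : a⁻¹ * c = (a⁻¹ * b) * (b⁻¹ * c) := by group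
      rw [h3]
      exact H.mul_mem h1 h2
  rw [eq_top_iff]
  intro g _
  have h := hP p (g • p) 1 g (by simpa using hD0) (by simpa using hD0)
  simpa using h

end ShortGenerators

/-! ### §3. Almost submetries -/

section AlmostSubmetry

variable {X Y : Type*} [PseudoMetricSpace X] [PseudoMetricSpace Y]

/-- A map `f : X → Y` between (pseudo)metric spaces (not necessarily continuous) is a
**`δ`-almost submetry at scale `r₀`** if for every `p ∈ X` and every `r ∈ (0, r₀)`,
`f(B_{r-δ}(p)) ⊆ B_r(f p) ⊆ T_δ(f(B_{r+δ}(p)))`, where `T_δ(A)` is the open `δ`-neighbourhood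
(`Metric.thickening δ A`) and all balls are open. This is hypothesis (i) of the paper's
Theorem 1.11 (equivariant regular almost submetry). Huang–Huang–Wang–Zhu 2026, §1, p. 5.
[cite: HuangHuangWangZhu2026, §1 p. 5 (definition of δ-almost submetry at scale r₀)] -/
def IsAlmostSubmetry (δ r₀ : ℝ) (f : X → Y) : Prop :=
  ∀ (p : X) (r : ℝ), 0 < r → r < r₀ →
    f '' ball p (r - δ) ⊆ ball (f p) r ∧ ball (f p) r ⊆ thickening δ (f '' ball p (r + δ))

/-- Unfolding lemma for `IsAlmostSubmetry`. [folklore] -/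
theorem isAlmostSubmetry_iff (δ r₀ : ℝ) (f : X → Y) :
    IsAlmostSubmetry δ r₀ f ↔ ∀ (p : X) (r : ℝ), 0 < r → r < r₀ →
      f '' ball p (r - δ) ⊆ ball (f p) r ∧ ball (f p) r ⊆ thickening δ (f '' ball p (r + δ)) :=
  Iff.rfl

/-- Monotonicity: a `δ`-almost submetry at scale `r₀` is a `δ'`-almost submetry at scale `r₀'`
whenever `δ ≤ δ'` and `r₀' ≤ r₀`. [folklore] -/
theorem IsAlmostSubmetry.mono {δ δ' r₀ r₀' : ℝ} {f : X → Y} (hf : IsAlmostSubmetry δ r₀ f)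
    (hδ : δ ≤ δ') (hr : r₀' ≤ r₀) : IsAlmostSubmetry δ' r₀' f := by
  intro p r hr0 hrr
  obtain ⟨h1, h2⟩ := hf p r hr0 (lt_of_lt_of_le hrr hr)
  refine ⟨(image_mono (ball_subset_ball (by linarith))).trans h1, h2.trans ?_⟩
  exact (thickening_mono hδ _).trans
    (thickening_subset_of_subset δ' (image_mono (ball_subset_ball (by linarith))))

/-- "If a map `f : X → Y` is a `δ/2`-Gromov–Hausdorff approximation, then it is a `δ`-almost
submetry" (Huang–Huang–Wang–Zhu 2026, §1, p. 5), at every scale `r₀`; here a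
`δ/2`-GH-approximation is a map with distortion `|d(f x₁, f x₂) - d(x₁, x₂)| ≤ δ/2` and `δ/2`-dense
image, and `δ > 0`. Proof: `d(x,p) < r - δ ⇒ d(fx, fp) ≤ d(x,p) + δ/2 < r`; and for
`y ∈ B_r(fp)` pick `x` with `d(fx, y) ≤ δ/2 < δ`: then
`d(x,p) ≤ d(fx,fp) + δ/2 ≤ d(fx,y) + d(y,fp) + δ/2 < r + δ`.
[cite: HuangHuangWangZhu2026, §1 p. 5] -/
theorem isAlmostSubmetry_of_ghApprox {δ : ℝ} (hδ : 0 < δ) {f : X → Y}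
    (hdist : ∀ x₁ x₂ : X, |dist (f x₁) (f x₂) - dist x₁ x₂| ≤ δ / 2)
    (hdense : ∀ y : Y, ∃ x : X, dist (f x) y ≤ δ / 2) (r₀ : ℝ) :
    IsAlmostSubmetry δ r₀ f := by
  intro p r _ _
  constructor
  · rintro _ ⟨x, hx, rfl⟩
    rw [mem_ball] at hx ⊢
    have h := (abs_le.mp (hdist x p)).2
    linarith
  · intro y hy
    rw [mem_ball] at hy
    obtain ⟨x, hx⟩ := hdense y
    rw [mem_thickening_iff]
    refine ⟨f x, ⟨x, ?_, rfl⟩, ?_⟩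
    · rw [mem_ball]
      have h1 := (abs_le.mp (hdist x p)).1
      have h2 : dist (f x) (f p) ≤ dist (f x) y + dist y (f p) := dist_triangle _ _ _
      linarith
    · rw [dist_comm]
      linarith

/-- "If `f` is a `δ`-almost submetry then it is `δ`-almost onto" (Huang–Huang–Wang–Zhu 2026, §1,
p. 5), in the precise form: a `δ`-almost submetry at scale `r₀` with `0 < δ < r₀`, from a nonempty
space onto a PRECONNECTED space `Y`, has `δ`-dense image, `∀ y, ∃ x, d(f x, y) < δ`. Proof: the set
`U = {y | ∃ x, d(fx, y) < δ}` is open, nonempty, and closed — if `y ∈ closure U`, pick `y' ∈ U`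
with `d(y,y') < (r₀-δ)/2` and `x'` with `d(fx', y') < δ`; then `y ∈ B_r(f x')` with
`r = δ + (r₀-δ)/2 ∈ (0, r₀)`, so `y ∈ T_δ(f(B_{r+δ}(x')))`, i.e. `y ∈ U`. (Some connectedness and
`δ < r₀` are needed: at scale `r₀ ≤ δ` the second inclusion says nothing about points far from the
image.) [cite: HuangHuangWangZhu2026, §1 p. 5] -/
theorem IsAlmostSubmetry.exists_dist_lt [PreconnectedSpace Y] [Nonempty X] {δ r₀ : ℝ}
    {f : X → Y} (hf : IsAlmostSubmetry δ r₀ f) (hδ : 0 < δ) (hδr : δ < r₀) (y : Y) :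
    ∃ x : X, dist (f x) y < δ := by
  let U : Set Y := {y | ∃ x : X, dist (f x) y < δ}
  suffices hU : U = univ by
    have hy : y ∈ U := hU ▸ mem_univ y
    exact hy
  refine IsClopen.eq_univ ⟨?_, ?_⟩ ?_
  · apply isClosed_of_closure_subset
    intro y hy
    rw [Metric.mem_closure_iff] at hy
    obtain ⟨y', ⟨x', hx'⟩, hyy'⟩ := hy ((r₀ - δ) / 2) (by linarith)
    have hr : dist (f x') y < δ + (r₀ - δ) / 2 := by
      calc dist (f x') y ≤ dist (f x') y' + dist y' y := dist_triangle _ _ _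
        _ < δ + (r₀ - δ) / 2 := by rw [dist_comm y' y]; linarith
    obtain ⟨-, h2⟩ := hf x' (δ + (r₀ - δ) / 2) (by linarith) (by linarith)
    have hyball : y ∈ ball (f x') (δ + (r₀ - δ) / 2) := by
      rw [mem_ball, dist_comm]
      exact hr
    obtain ⟨z, ⟨x, -, rfl⟩, hz⟩ := mem_thickening_iff.mp (h2 hyball)
    exact ⟨x, by rw [dist_comm]; exact hz⟩
  · have hU' : U = ⋃ x : X, ball (f x) δ := by
      ext y
      simp only [U, mem_setOf_eq, mem_iUnion, mem_ball]
      constructor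
      · rintro ⟨x, hx⟩
        exact ⟨x, by rwa [dist_comm]⟩
      · rintro ⟨x, hx⟩
        exact ⟨x, by rwa [dist_comm]⟩
    rw [hU']
    exact isOpen_iUnion fun _ ↦ isOpen_ball
  · obtain ⟨x⟩ := ‹Nonempty X›
    exact ⟨f x, x, by simpa using hδ⟩

end AlmostSubmetry

/-! ### §4. A lattice inside a dense group of translations -/

section Lattice

open WithLp

variable {s : ℕ}

/-- Coordinates: `∑ᵢ yᵢ eᵢ` is the vector with coordinates `y` in `EuclideanSpace ℝ (Fin s)`
(`eᵢ = EuclideanSpace.single i 1`). [folklore] -/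
theorem sum_smul_single_eq_toLp (y : Fin s → ℝ) :
    ∑ i, y i • EuclideanSpace.single i (1 : ℝ) = toLp 2 y := by
  ext j
  simp [WithLp.ofLp_sum, Finset.sum_apply, Pi.single_apply]

/-- Cauchy–Schwarz between the `ℓ¹` and `ℓ²` norms on `ℝˢ`: `∑ᵢ |yᵢ| ≤ √s ‖y‖₂`
(from Mathlib's `Finset.sum_mul_sq_le_sq_mul_sq`). [folklore] -/
theorem sum_abs_le_sqrt_mul_norm (y : Fin s → ℝ) :
    ∑ i, |y i| ≤ √(s : ℝ) * ‖toLp 2 y‖ := by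
  have hcs := Finset.sum_mul_sq_le_sq_mul_sq Finset.univ (fun _ : Fin s ↦ (1 : ℝ)) (fun i ↦ |y i|)
  simp only [one_mul, one_pow, Finset.sum_const, Finset.card_univ, Fintype.card_fin,
    nsmul_eq_mul, mul_one, sq_abs] at hcs
  have hnorm : ‖toLp 2 y‖ ^ 2 = ∑ i, (y i) ^ 2 := by
    rw [EuclideanSpace.real_norm_sq_eq]
  have h0 : 0 ≤ √(s : ℝ) * ‖toLp 2 y‖ := by positivity
  rw [← pow_le_pow_iff_left₀ (Finset.sum_nonneg fun i _ ↦ abs_nonneg (y i)) h0 two_ne_zero,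
    mul_pow, Real.sq_sqrt (Nat.cast_nonneg s), hnorm]
  exact hcs

/-- LATTICE SELECTION (Huang–Huang–Wang–Zhu 2026, §4, p. 13: for the cocompact group `G` of
translations of `ℝˢ` with `diam(ℝˢ/G) ≤ 1`, "we take a discrete subgroup `G₀` of `G` such that the
flat torus `Tˢ := ℝˢ/G₀` satisfies `1 ≤ diam(Tˢ) ≤ 4n`, and `inj_{Tˢ} ≥ 1`", `s ≤ n`; stated there
without proof). Precisely: if `A` is an additive subgroup of `EuclideanSpace ℝ (Fin s)` whose orbit
of `0` is `1`-dense (`∀ x, ∃ a ∈ A, ‖a - x‖ ≤ 1`), there are `v₁, …, vₛ ∈ A`, linearly independent,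
with, for all real coefficient vectors `y`, `2‖y‖ ≤ ‖∑ yᵢ vᵢ‖ ≤ (2√s + 2)‖y‖`; consequently every
nonzero vector of the lattice `Λ = ⊕ ℤvᵢ` has norm `≥ 2` (`inj(ℝˢ/Λ) ≥ 1`), every point of `ℝˢ` is
within `2s (≤ 4n)` of `Λ` (`diam(ℝˢ/Λ) ≤ 2s`), and `v_{i₀}/2` is at distance `≥ 1` from `Λ`
(`diam(ℝˢ/Λ) ≥ 1`). Construction: `vᵢ ∈ A` with `‖vᵢ - (√s+2) eᵢ‖ ≤ 1`; then
`‖∑ yᵢ vᵢ - (√s+2) y‖ ≤ ∑ |yᵢ| ≤ √s‖y‖`; covering by rounding coordinates (`|t - round t| ≤ 1/2`)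
after inverting `y ↦ ∑ yᵢvᵢ` (injective, hence onto by dimension count).
[cite: HuangHuangWangZhu2026, §4 p. 13 (choice of G₀ with 1 ≤ diam Tˢ ≤ 4n, inj ≥ 1)] -/
theorem exists_lattice_of_dense_addSubgroup (A : AddSubgroup (EuclideanSpace ℝ (Fin s)))
    (hA : ∀ x : EuclideanSpace ℝ (Fin s), ∃ a ∈ A, ‖a - x‖ ≤ 1) :
    ∃ v : Fin s → EuclideanSpace ℝ (Fin s),
      (∀ i, v i ∈ A) ∧ LinearIndependent ℝ v ∧
      (∀ y : Fin s → ℝ, 2 * ‖toLp 2 y‖ ≤ ‖∑ i, y i • v i‖) ∧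
      (∀ y : Fin s → ℝ, ‖∑ i, y i • v i‖ ≤ (2 * √(s : ℝ) + 2) * ‖toLp 2 y‖) ∧
      (∀ m : Fin s → ℤ, m ≠ 0 → 2 ≤ ‖∑ i, (m i : ℝ) • v i‖) ∧
      (∀ x : EuclideanSpace ℝ (Fin s), ∃ m : Fin s → ℤ, ‖x - ∑ i, (m i : ℝ) • v i‖ ≤ 2 * s) ∧
      (∀ (i₀ : Fin s) (m : Fin s → ℤ), 1 ≤ ‖(1 / 2 : ℝ) • v i₀ - ∑ i, (m i : ℝ) • v i‖) := by
  set c : ℝ := √(s : ℝ) + 2 with hc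
  have hc0 : 0 ≤ c := by positivity
  choose v hvA hv using fun i : Fin s ↦ hA (c • EuclideanSpace.single i (1 : ℝ))
  -- deviation from `c • id`
  have hdev : ∀ y : Fin s → ℝ, ‖∑ i, y i • v i - c • toLp 2 y‖ ≤ √(s : ℝ) * ‖toLp 2 y‖ := by
    intro y
    have hrw : ∑ i, y i • v i - c • toLp 2 y
        = ∑ i, y i • (v i - c • EuclideanSpace.single i 1) := by
      rw [← sum_smul_single_eq_toLp, Finset.smul_sum, ← Finset.sum_sub_distrib]
      refine Finset.sum_congr rfl fun i _ ↦ ?_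
      rw [smul_sub, smul_comm (y i) c]
    rw [hrw]
    calc ‖∑ i, y i • (v i - c • EuclideanSpace.single i 1)‖
        ≤ ∑ i, ‖y i • (v i - c • EuclideanSpace.single i 1)‖ := norm_sum_le _ _
      _ ≤ ∑ i, |y i| := by
          refine Finset.sum_le_sum fun i _ ↦ ?_
          rw [norm_smul, Real.norm_eq_abs]
          exact mul_le_of_le_one_right (abs_nonneg _) (hv i)
      _ ≤ √(s : ℝ) * ‖toLp 2 y‖ := sum_abs_le_sqrt_mul_norm y
  have hnc : ∀ y : Fin s → ℝ, ‖c • toLp 2 y‖ = c * ‖toLp 2 y‖ := fun y ↦ by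
    rw [norm_smul, Real.norm_eq_abs, abs_of_nonneg hc0]
  have hlow : ∀ y : Fin s → ℝ, 2 * ‖toLp 2 y‖ ≤ ‖∑ i, y i • v i‖ := by
    intro y
    have h1 : ‖c • toLp 2 y‖ ≤ ‖∑ i, y i • v i‖ + ‖∑ i, y i • v i - c • toLp 2 y‖ := by
      calc ‖c • toLp 2 y‖ = ‖∑ i, y i • v i - (∑ i, y i • v i - c • toLp 2 y)‖ := by
            rw [sub_sub_cancel]
        _ ≤ _ := norm_sub_le _ _
    have h2 := hdev y
    rw [hnc] at h1
    have h3 : c * ‖toLp 2 y‖ - √(s : ℝ) * ‖toLp 2 y‖ = 2 * ‖toLp 2 y‖ := by rw [hc]; ring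
    linarith
  have hup : ∀ y : Fin s → ℝ, ‖∑ i, y i • v i‖ ≤ (2 * √(s : ℝ) + 2) * ‖toLp 2 y‖ := by
    intro y
    have h1 : ‖∑ i, y i • v i‖ ≤ ‖c • toLp 2 y‖ + ‖∑ i, y i • v i - c • toLp 2 y‖ := by
      calc ‖∑ i, y i • v i‖ = ‖c • toLp 2 y + (∑ i, y i • v i - c • toLp 2 y)‖ := by
            rw [add_sub_cancel]
        _ ≤ _ := norm_add_le _ _
    rw [hnc] at h1
    have h2 := hdev y
    have h3 : c * ‖toLp 2 y‖ + √(s : ℝ) * ‖toLp 2 y‖ = (2 * √(s : ℝ) + 2) * ‖toLp 2 y‖ := by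
      rw [hc]; ring
    linarith
  -- kernel triviality on real coefficients
  have hker : ∀ y : Fin s → ℝ, ∑ i, y i • v i = 0 → y = 0 := by
    intro y hy
    have h := hlow y
    rw [hy, norm_zero] at h
    have h0 : ‖toLp 2 y‖ = 0 := by linarith [norm_nonneg (toLp 2 y)]
    have h1 : toLp 2 y = 0 := norm_eq_zero.mp h0
    funext i
    have h2 := congrArg (fun z : EuclideanSpace ℝ (Fin s) ↦ z i) h1
    simpa using h2
  have hli : LinearIndependent ℝ v := by
    rw [Fintype.linearIndependent_iff]
    intro g hg i
    exact congrFun (hker g hg) i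
  have hint : ∀ m : Fin s → ℤ, m ≠ 0 → 2 ≤ ‖∑ i, (m i : ℝ) • v i‖ := by
    intro m hm
    obtain ⟨i, hi⟩ := Function.ne_iff.mp hm
    have h1 : (1 : ℝ) ≤ |(m i : ℝ)| := by
      rw [← Int.cast_abs]
      exact_mod_cast Int.one_le_abs hi
    have h2 : |(m i : ℝ)| ≤ ‖toLp 2 (fun i ↦ (m i : ℝ))‖ := by
      have := PiLp.norm_apply_le (toLp 2 (fun i ↦ (m i : ℝ))) i
      simpa using this
    have h3 := hlow (fun i ↦ (m i : ℝ))
    linarith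
  have hcov : ∀ x : EuclideanSpace ℝ (Fin s), ∃ m : Fin s → ℤ,
      ‖x - ∑ i, (m i : ℝ) • v i‖ ≤ 2 * s := by
    intro x
    let L : (Fin s → ℝ) →ₗ[ℝ] EuclideanSpace ℝ (Fin s) := Fintype.linearCombination ℝ v
    have hLapply : ∀ y, L y = ∑ i, y i • v i := fun y ↦ Fintype.linearCombination_apply ℝ v y
    have hinj : Function.Injective L := by
      rw [← LinearMap.ker_eq_bot, LinearMap.ker_eq_bot']
      intro y hy
      rw [hLapply] at hy
      exact hker y hy
    have hsurj : Function.Surjective L :=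
      (LinearMap.injective_iff_surjective_of_finrank_eq_finrank (by simp)).mp hinj
    obtain ⟨y, rfl⟩ := hsurj x
    refine ⟨fun i ↦ round (y i), ?_⟩
    have hdiff : L y - ∑ i, ((round (y i) : ℤ) : ℝ) • v i = ∑ i, (y i - round (y i)) • v i := by
      rw [hLapply, ← Finset.sum_sub_distrib]
      refine Finset.sum_congr rfl fun i _ ↦ ?_
      rw [sub_smul]
    rw [hdiff]
    have h1 := hup (fun i ↦ y i - round (y i))
    have h2 : ‖toLp 2 (fun i ↦ y i - (round (y i) : ℝ))‖ ≤ √(s : ℝ) / 2 := by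
      rw [EuclideanSpace.norm_eq]
      have hle : ∑ i, ‖(toLp 2 fun i ↦ y i - (round (y i) : ℝ)) i‖ ^ 2 ≤ (s : ℝ) / 4 := by
        calc ∑ i, ‖(toLp 2 fun i ↦ y i - (round (y i) : ℝ)) i‖ ^ 2
            ≤ ∑ _i : Fin s, (1 / 2 : ℝ) ^ 2 := by
              refine Finset.sum_le_sum fun i _ ↦ ?_
              have hr : |y i - (round (y i) : ℝ)| ≤ 1 / 2 := abs_sub_round (y i)
              have : ‖(toLp 2 fun i ↦ y i - (round (y i) : ℝ)) i‖ = |y i - (round (y i) : ℝ)| := rfl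
              rw [this]
              exact pow_le_pow_left₀ (abs_nonneg _) hr 2
          _ = (s : ℝ) / 4 := by simp; ring
      calc √(∑ i, ‖(toLp 2 fun i ↦ y i - (round (y i) : ℝ)) i‖ ^ 2) ≤ √((s : ℝ) / 4) :=
            Real.sqrt_le_sqrt hle
        _ = √(s : ℝ) / 2 := by
            rw [Real.sqrt_div (Nat.cast_nonneg _), show (4 : ℝ) = 2 ^ 2 by norm_num,
              Real.sqrt_sq (by norm_num)]
    have hs : √(s : ℝ) ≤ s := by
      rw [Real.sqrt_le_left (Nat.cast_nonneg _)]
      exact_mod_cast Nat.le_self_pow two_ne_zero s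
    have h0 : 0 ≤ √(s : ℝ) := Real.sqrt_nonneg _
    calc ‖∑ i, (y i - ↑(round (y i))) • v i‖
        ≤ (2 * √(s : ℝ) + 2) * ‖toLp 2 fun i ↦ y i - ↑(round (y i))‖ := h1
      _ ≤ (2 * √(s : ℝ) + 2) * (√(s : ℝ) / 2) := by gcongr
      _ = √(s : ℝ) * √(s : ℝ) + √(s : ℝ) := by ring
      _ = (s : ℝ) + √(s : ℝ) := by rw [Real.mul_self_sqrt (Nat.cast_nonneg s)]
      _ ≤ 2 * s := by linarith
  have hhalf : ∀ (i₀ : Fin s) (m : Fin s → ℤ), 1 ≤ ‖(1 / 2 : ℝ) • v i₀ - ∑ i, (m i : ℝ) • v i‖ := by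
    intro i₀ m
    let y : Fin s → ℤ := fun i ↦ (if i = i₀ then 1 else 0) - 2 * m i
    have hy : y ≠ 0 := by
      intro h
      have h1 := congrFun h i₀
      simp only [y, if_true, Pi.zero_apply] at h1
      omega
    have h2 := hint y hy
    have hrw : (1 / 2 : ℝ) • v i₀ - ∑ i, (m i : ℝ) • v i = (1 / 2 : ℝ) • ∑ i, (y i : ℝ) • v i := by
      have hsum : ∑ i, (y i : ℝ) • v i = v i₀ - (2 : ℝ) • ∑ i, (m i : ℝ) • v i := by
        simp only [y, Int.cast_sub, Int.cast_mul, Int.cast_ite, Int.cast_one, Int.cast_zero,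
          Int.cast_ofNat, sub_smul, Finset.sum_sub_distrib, ite_smul, one_smul, zero_smul,
          Finset.sum_ite_eq', Finset.mem_univ, if_true, Finset.smul_sum, smul_smul]
      rw [hsum, smul_sub, smul_smul]
      norm_num
    rw [hrw, norm_smul]
    norm_num
    linarith
  exact ⟨v, hvA, hli, hlow, hup, hint, hcov, hhalf⟩

end Lattice

/-! ### §5. Submetries vs almost submetries; stability under uniform perturbation -/

section SubmetryAlmost

open Literature.Geometry.MetricGeometry

variable {X Y : Type*} [PseudoMetricSpace X] [PseudoMetricSpace Y]

/-- A submetry at scale `r₀` (`f(B_r(p)) = B_r(f p)` for `r < r₀`,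
`Literature.Geometry.MetricGeometry.IsSubmetryAtScale`) is a `δ`-almost submetry at scale `r₀` for
every `δ > 0`: `f(B_{r-δ}(p)) ⊆ f(B_r(p)) = B_r(f p)`, and every point of `B_r(f p) = f(B_r(p))` is at
distance `0 < δ` from a point of `f(B_{r+δ}(p))`. (Huang–Huang–Wang–Zhu 2026, §4 p. 13: "`F` is a
submetry at scale `1/4`", used on p. 14 as an almost submetry.) [cite: HuangHuangWangZhu2026, §4 pp. 13–14] -/
theorem _root_.Literature.Geometry.MetricGeometry.IsSubmetryAtScale.isAlmostSubmetry
    {r₀ : ℝ} {f : X → Y} (hf : IsSubmetryAtScale r₀ f) {δ : ℝ} (hδ : 0 < δ) :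
    IsAlmostSubmetry δ r₀ f := by
  intro p r hr hrr
  have heq := hf p r hr hrr
  refine ⟨(image_mono (ball_subset_ball (by linarith))).trans heq.subset, ?_⟩
  rw [← heq]
  rintro _ ⟨x, hx, rfl⟩
  exact mem_thickening_iff.mpr ⟨f x, ⟨x, ball_subset_ball (by linarith) hx, rfl⟩, by simpa using hδ⟩

/-- STABILITY OF SUBMETRIES UNDER UNIFORM PERTURBATION (fixed-space form of Huang–Huang–Wang–Zhu
2026, §4 p. 14: "Since `Fᵢ` converges uniformly to `F` and `F` is a submetry at scale `1/4`, `Fᵢ` is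
a `εᵢ`-submetry at scale `1/4`"): if `F : X → Y` is a submetry at scale `r₀` and
`dist (F' x) (F x) ≤ η` for all `x`, then `F'` is a `δ`-almost submetry at scale `r₀ - η` whenever
`0 < δ` and `2η ≤ δ`. Proof: `dist (F' x) (F' p) ≤ dist (F x) (F p) + 2η ≤ dist x p + 2η < r` for
`dist x p < r - δ`; and for `dist y (F' p) < r`, `dist y (F p) < r + η < r₀`, so `y = F x` with
`dist x p < r + η ≤ r + δ`, and `dist y (F' x) ≤ η < δ`. [cite: HuangHuangWangZhu2026, §4 p. 14] -/
theorem _root_.Literature.Geometry.MetricGeometry.IsSubmetryAtScale.isAlmostSubmetry_of_dist_le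
    {r₀ η δ : ℝ} {F F' : X → Y} (hF : IsSubmetryAtScale r₀ F) (hη : ∀ x, dist (F' x) (F x) ≤ η)
    (hδ : 0 < δ) (hηδ : 2 * η ≤ δ) : IsAlmostSubmetry δ (r₀ - η) F' := by
  intro p r hr hrr
  have hη0 : 0 ≤ η := dist_nonneg.trans (hη p)
  have hηδ' : η < δ := by linarith
  constructor
  · rintro _ ⟨x, hx, rfl⟩
    rw [mem_ball] at hx ⊢
    have h1 : dist (F x) (F p) ≤ dist x p := hF.dist_le (by linarith)
    have hx' := hη x
    have hp' : dist (F p) (F' p) ≤ η := by rw [dist_comm]; exact hη p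
    calc dist (F' x) (F' p) ≤ dist (F' x) (F x) + dist (F x) (F p) + dist (F p) (F' p) :=
          dist_triangle4 _ _ _ _
      _ < r := by linarith
  · intro y hy
    rw [mem_ball] at hy
    have hp' := hη p
    have h1 : dist y (F p) < r + η := by
      calc dist y (F p) ≤ dist y (F' p) + dist (F' p) (F p) := dist_triangle _ _ _
        _ < r + η := by linarith
    obtain ⟨x, hx, hdist⟩ := hF.exists_eq_of_dist_lt h1 (by linarith)
    rw [mem_thickening_iff]
    refine ⟨F' x, ⟨x, mem_ball.mpr (by linarith), rfl⟩, ?_⟩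
    calc dist y (F' x) ≤ dist y (F x) + dist (F x) (F' x) := dist_triangle _ _ _
      _ = dist (F' x) (F x) := by rw [hx, dist_self, zero_add, dist_comm]
      _ ≤ η := hη x
      _ < δ := hηδ'

end SubmetryAlmost

/-! ### §6. Gromov–Hausdorff approximations and Mathlib's Gromov–Hausdorff distance -/

section GHApprox

/-- BRIDGE TO MATHLIB'S GROMOV–HAUSDORFF DISTANCE. An `ε`-Gromov–Hausdorff approximation
`f : X → Y` between nonempty compact metric spaces in the convention of
`isAlmostSubmetry_of_ghApprox` (distortion `|d(f x₁, f x₂) - d(x₁, x₂)| ≤ ε` and `ε`-dense image)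
bounds the Gromov–Hausdorff distance of Mathlib's `GromovHausdorff.ghDist`:
`d_GH(X, Y) ≤ 3ε/2` (Mathlib's `GromovHausdorff.ghDist_le_of_approx_subsets` with `s = univ`,
`ε₁ = 0`, `ε₂ = ε₃ = ε`). This is the sense in which the convergences `Mᵢ → X`,
`(M̂ᵢ, p̂ᵢ) → (ℝˢ × Ŷ, ·)` of Huang–Huang–Wang–Zhu 2026, §2.1 and §4 (given there by approximations)
are convergences in Gromov–Hausdorff distance, in the compact non-pointed case. [folklore] -/
theorem ghDist_le_of_ghApprox {X : Type*} [MetricSpace X] [CompactSpace X] [Nonempty X]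
    {Y : Type*} [MetricSpace Y] [CompactSpace Y] [Nonempty Y] {ε : ℝ} {f : X → Y}
    (hdist : ∀ x₁ x₂ : X, |dist (f x₁) (f x₂) - dist x₁ x₂| ≤ ε)
    (hdense : ∀ y : Y, ∃ x : X, dist (f x) y ≤ ε) :
    GromovHausdorff.ghDist X Y ≤ 3 * ε / 2 := by
  have h := GromovHausdorff.ghDist_le_of_approx_subsets (s := (univ : Set X))
    (fun x ↦ f x) (ε₁ := 0) (ε₂ := ε) (ε₃ := ε)
    (fun x ↦ ⟨x, mem_univ x, by simp⟩)
    (fun y ↦ by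
      obtain ⟨x, hx⟩ := hdense y
      exact ⟨⟨x, mem_univ x⟩, by rwa [dist_comm]⟩)
    (fun x y ↦ by
      rw [abs_sub_comm]
      exact hdist x y)
  linarith

end GHApprox

/-! ### §7. The lattice `H₀ ≤ H`, the torus `Tˢ = ℝˢ/Π₁(H₀)` and `X̄ = (ℝˢ × Ŷ)/H₀` (p. 13)

The second half of p. 13 of Huang–Huang–Wang–Zhu 2026, from "Note that `H` acts separately on the
two factors of `ℝˢ × Ŷ`" to "`F` is a submetry at scale `1/4`", assembled from §1 (translations),
§4 (lattice selection), `ProductIsometrySplitting.lean` (`Π₁ = fstComponentHom`, the action of a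
subgroup of `Isom(ℝˢ ×₂ Ŷ)` on `ℝˢ` through `Π₁`, the submetry of orbit spaces) and `Submetry.lean`
(orbit pseudometric). INPUT (what the limiting argument of p. 13 provides and is NOT proved here):
an abelian subgroup `H ≤ Isom(ℝˢ ×₂ Ŷ)` (`Ŷ` a nonempty bounded metric space) whose action is
`1`-cobounded, `∀ x x', ∃ h ∈ H, d(h x, x') ≤ 1` (from `diam Mᵢ ≤ 1`). OUTPUT
(`exists_latticeSubgroup`): every `Π₁(h)`, `h ∈ H`, is a translation; there are `H₀ ≤ H` and a basis
`b` of `ℝˢ` such that `Π₁(H₀)` is exactly the group of translations by the lattice `Λ = ⊕ ℤbᵢ`, with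
`2‖y‖ ≤ ‖∑ yᵢbᵢ‖ ≤ (2√s+2)‖y‖`, nonzero lattice vectors of norm `≥ 2`, covering radius `≤ 2s`;
consequently (`torus_dist_eq_of_dist_le_one`, `torus_dist_le`, `one_le_torus_dist`) the flat torus
`Tˢ = ℝˢ/Π₁(H₀)` has injectivity radius `≥ 1` (the orbit map is isometric on pairs at distance
`≤ 1`), `diam Tˢ ≤ 2s (≤ 4n)` and `diam Tˢ ≥ 1`; `diam X̄ ≤ √((2s)² + D²)` for `X̄ = (ℝˢ ×₂ Ŷ)/H₀`,
`D ≥ diam Ŷ` (`xbar_dist_le`; the paper writes `√(D² + (4n)²)`); and `F : X̄ → Tˢ` is a submetry at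
every scale (`Literature.Geometry.MetricGeometry.isSubmetry_orbitQuotientMap_fst`). -/

section TorusPackage

open Literature.Geometry.MetricGeometry WithLp

variable {s : ℕ}

/-- Integer combinations `∑ mᵢ bᵢ` of a family `b` of vectors of `ℝˢ` (the lattice `⊕ ℤbᵢ` when `b`
is a basis). [folklore] -/
def latVec (b : Fin s → EuclideanSpace ℝ (Fin s)) (m : Fin s → ℤ) : EuclideanSpace ℝ (Fin s) :=
  ∑ i, (m i : ℝ) • b i

/-- Unfolding lemma for `latVec`. [folklore] -/
theorem latVec_apply (b : Fin s → EuclideanSpace ℝ (Fin s)) (m : Fin s → ℤ) :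
    latVec b m = ∑ i, (m i : ℝ) • b i :=
  rfl

/-- `latVec b 0 = 0`. [folklore] -/
@[simp]
theorem latVec_zero (b : Fin s → EuclideanSpace ℝ (Fin s)) : latVec b 0 = 0 := by
  simp [latVec]

/-- Additivity of `latVec b`. [folklore] -/
theorem latVec_add (b : Fin s → EuclideanSpace ℝ (Fin s)) (m m' : Fin s → ℤ) :
    latVec b (m + m') = latVec b m + latVec b m' := by
  simp [latVec, add_smul, Finset.sum_add_distrib]

/-- `latVec b (-m) = -latVec b m`. [folklore] -/
theorem latVec_neg (b : Fin s → EuclideanSpace ℝ (Fin s)) (m : Fin s → ℤ) :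
    latVec b (-m) = -latVec b m := by
  simp [latVec, neg_smul, Finset.sum_neg_distrib]

/-- `latVec b eᵢ = bᵢ`. [folklore] -/
theorem latVec_single (b : Fin s → EuclideanSpace ℝ (Fin s)) (i : Fin s) :
    latVec b (Pi.single i 1) = b i := by
  classical
  simp [latVec, Pi.single_apply, ite_smul, Finset.sum_ite_eq']

/-! #### The geometry of a torus `ℝˢ/Γ`, `Γ` acting by the translations of a good lattice -/

variable {Γ : Type*} [Group Γ] [MulAction Γ (EuclideanSpace ℝ (Fin s))]
  [IsIsometricSMul Γ (EuclideanSpace ℝ (Fin s))] {b : Fin s → EuclideanSpace ℝ (Fin s)}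

/-- INJECTIVITY RADIUS `≥ 1` ("inj_{Tˢ} ≥ 1", p. 13): if a group `Γ` acts on `ℝˢ` by translations
by vectors of a lattice all of whose nonzero vectors have norm `≥ 2`, the orbit map `ℝˢ → ℝˢ/Γ`
preserves the distance of any two points at distance `≤ 1`.
[cite: HuangHuangWangZhu2026, §4 p. 13] -/
theorem torus_dist_eq_of_dist_le_one
    (hmem : ∀ γ : Γ, ∃ m : Fin s → ℤ, ∀ v : EuclideanSpace ℝ (Fin s), γ • v = v + latVec b m)
    (hsep : ∀ m : Fin s → ℤ, m ≠ 0 → 2 ≤ ‖latVec b m‖) {a a' : EuclideanSpace ℝ (Fin s)}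
    (h : dist a a' ≤ 1) :
    dist (⟦a⟧ : MulAction.orbitRel.Quotient Γ (EuclideanSpace ℝ (Fin s))) ⟦a'⟧ = dist a a' := by
  refine le_antisymm (dist_mk_mk_le a a') ?_
  rw [dist_mk_mk]
  refine le_ciInf fun γ ↦ ?_
  obtain ⟨m, hm⟩ := hmem γ
  rw [hm a']
  by_cases hm0 : m = 0
  · rw [hm0, latVec_zero, add_zero]
  · have h2 := hsep m hm0
    have h3 : ‖latVec b m‖ ≤ ‖a - a'‖ + ‖a - (a' + latVec b m)‖ := by
      calc ‖latVec b m‖ = ‖(a - a') - (a - (a' + latVec b m))‖ := by congr 1; abel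
        _ ≤ ‖a - a'‖ + ‖a - (a' + latVec b m)‖ := norm_sub_le _ _
    rw [dist_eq_norm] at h ⊢
    rw [dist_eq_norm]
    linarith

/-- `diam(ℝˢ/Γ) ≤ 2s` ("diam Tˢ ≤ 4n", p. 13, `s ≤ n`): if every lattice vector is realised by `Γ`
and the lattice has covering radius `≤ 2s`. [cite: HuangHuangWangZhu2026, §4 p. 13] -/
theorem torus_dist_le
    (hreal : ∀ m : Fin s → ℤ, ∃ γ : Γ, ∀ v : EuclideanSpace ℝ (Fin s), γ • v = v + latVec b m)
    (hcov : ∀ x : EuclideanSpace ℝ (Fin s), ∃ m : Fin s → ℤ, ‖x - latVec b m‖ ≤ 2 * s)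
    (a a' : EuclideanSpace ℝ (Fin s)) :
    dist (⟦a⟧ : MulAction.orbitRel.Quotient Γ (EuclideanSpace ℝ (Fin s))) ⟦a'⟧ ≤ 2 * s := by
  obtain ⟨m, hm⟩ := hcov (a - a')
  obtain ⟨γ, hγ⟩ := hreal m
  calc dist (⟦a⟧ : MulAction.orbitRel.Quotient Γ (EuclideanSpace ℝ (Fin s))) ⟦a'⟧
      ≤ dist a (γ • a') := dist_mk_mk_le_dist_smul a a' γ
    _ = ‖a - a' - latVec b m‖ := by rw [hγ, dist_eq_norm]; congr 1; abel
    _ ≤ 2 * s := hm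

/-- `diam(ℝˢ/Γ) ≥ 1` ("1 ≤ diam Tˢ", p. 13): the classes of `bᵢ₀/2` and `0` are at distance `≥ 1`
when `bᵢ₀/2` is at distance `≥ 1` from the lattice. [cite: HuangHuangWangZhu2026, §4 p. 13] -/
theorem one_le_torus_dist
    (hmem : ∀ γ : Γ, ∃ m : Fin s → ℤ, ∀ v : EuclideanSpace ℝ (Fin s), γ • v = v + latVec b m)
    (hhalf : ∀ (i₀ : Fin s) (m : Fin s → ℤ), 1 ≤ ‖(1 / 2 : ℝ) • b i₀ - latVec b m‖)
    (i₀ : Fin s) :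
    1 ≤ dist (⟦(1 / 2 : ℝ) • b i₀⟧ : MulAction.orbitRel.Quotient Γ (EuclideanSpace ℝ (Fin s)))
      ⟦0⟧ := by
  rw [dist_mk_mk]
  refine le_ciInf fun γ ↦ ?_
  obtain ⟨m, hm⟩ := hmem γ
  rw [hm, zero_add, dist_eq_norm]
  exact hhalf i₀ m

/-! #### Subgroups of `Isom(ℝˢ ×₂ Ŷ)`: the lattice subgroup `H₀ ≤ H` -/

variable {Y : Type*} [MetricSpace Y] [BoundedSpace Y] [Nonempty Y]

/-- The additive group of integer coefficient vectors `m` whose lattice vector `latVec b m` is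
realised, as a translation of `ℝˢ` through `Π₁`, by an element of a subgroup `H₀ ≤ Isom(ℝˢ ×₂ Ŷ)`.
[folklore] -/
def realizedCoeffs
    (H₀ : Subgroup (WithLp 2 (EuclideanSpace ℝ (Fin s) × Y) ≃ᵢ
      WithLp 2 (EuclideanSpace ℝ (Fin s) × Y)))
    (b : Fin s → EuclideanSpace ℝ (Fin s)) : AddSubgroup (Fin s → ℤ) where
  carrier := {m | ∃ g ∈ H₀, ∀ v : EuclideanSpace ℝ (Fin s),
    fstComponentHom (g : WithLp 2 (EuclideanSpace ℝ (Fin s) × Y) ≃ᵢ _) v = v + latVec b m}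
  zero_mem' := ⟨1, H₀.one_mem, fun v ↦ by
    rw [map_one, IsometryEquiv.coe_one, id, latVec_zero, add_zero]⟩
  add_mem' := by
    rintro m m' ⟨g, hg, hgm⟩ ⟨g', hg', hgm'⟩
    refine ⟨g * g', H₀.mul_mem hg hg', fun v ↦ ?_⟩
    rw [map_mul, IsometryEquiv.mul_apply, hgm', hgm, latVec_add]
    abel
  neg_mem' := by
    rintro m ⟨g, hg, hgm⟩
    refine ⟨g⁻¹, H₀.inv_mem hg, fun v ↦ ?_⟩
    have h1 := hgm (fstComponentHom (g⁻¹ : WithLp 2 (EuclideanSpace ℝ (Fin s) × Y) ≃ᵢ _) v)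
    rw [← IsometryEquiv.mul_apply, ← map_mul, mul_inv_cancel, map_one, IsometryEquiv.coe_one,
      id] at h1
    rw [latVec_neg, ← sub_eq_add_neg]
    exact eq_sub_of_add_eq h1.symm

/-- Membership in `realizedCoeffs`. [folklore] -/
theorem mem_realizedCoeffs_iff
    (H₀ : Subgroup (WithLp 2 (EuclideanSpace ℝ (Fin s) × Y) ≃ᵢ
      WithLp 2 (EuclideanSpace ℝ (Fin s) × Y)))
    (b : Fin s → EuclideanSpace ℝ (Fin s)) (m : Fin s → ℤ) :
    m ∈ realizedCoeffs H₀ b ↔ ∃ g ∈ H₀, ∀ v : EuclideanSpace ℝ (Fin s),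
      fstComponentHom (g : WithLp 2 (EuclideanSpace ℝ (Fin s) × Y) ≃ᵢ _) v = v + latVec b m :=
  Iff.rfl

/-- THE LATTICE SUBGROUP (Huang–Huang–Wang–Zhu 2026, §4 p. 13: "`G = Im(Π₁)` … each element of `G`
acts as a translation on `ℝˢ`. We take a discrete subgroup `G₀` of `G` such that the flat torus
`Tˢ := ℝˢ/G₀` satisfies `1 ≤ diam(Tˢ) ≤ 4n` and `inj_{Tˢ} ≥ 1` … Let `{η₁, …, ηₛ}` be linear
independent generators of `G₀` … fix `γᵢ ∈ H` such that `Π₁(γᵢ) = ηᵢ` … `H₀ := span{γ₁, …, γₛ}`").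
For an ABELIAN subgroup `H ≤ Isom(ℝˢ ×₂ Ŷ)` (`Ŷ` a nonempty bounded metric space) with
`1`-cobounded action: (i) every `Π₁(h)`, `h ∈ H`, is a translation (§1); (ii) there are
`H₀ ≤ H` and a linearly independent `b : Fin s → ℝˢ` (from §4 applied to the translation vectors
of `Π₁(H)`) with `2‖y‖ ≤ ‖∑ yᵢbᵢ‖ ≤ (2√s+2)‖y‖`, such that `Π₁(H₀)` consists exactly of the
translations by the lattice vectors `∑ mᵢbᵢ`, every nonzero lattice vector has norm `≥ 2`, the
covering radius is `≤ 2s`, and `bᵢ₀/2` is at distance `≥ 1` from the lattice. `H₀` is the subgroup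
generated by chosen lifts `γᵢ ∈ H` of the translations by `bᵢ`.
[cite: HuangHuangWangZhu2026, §4 p. 13] -/
theorem exists_latticeSubgroup
    (H : Subgroup (WithLp 2 (EuclideanSpace ℝ (Fin s) × Y) ≃ᵢ
      WithLp 2 (EuclideanSpace ℝ (Fin s) × Y)))
    (hcomm : ∀ g ∈ H, ∀ h ∈ H, g * h = h * g)
    (hcob : ∀ x x' : WithLp 2 (EuclideanSpace ℝ (Fin s) × Y), ∃ h ∈ H, dist (h x) x' ≤ 1) :
    (∀ h ∈ H, ∃ w : EuclideanSpace ℝ (Fin s), ∀ v : EuclideanSpace ℝ (Fin s),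
        fstComponentHom h v = v + w) ∧
    ∃ (H₀ : Subgroup (WithLp 2 (EuclideanSpace ℝ (Fin s) × Y) ≃ᵢ
        WithLp 2 (EuclideanSpace ℝ (Fin s) × Y)))
      (b : Fin s → EuclideanSpace ℝ (Fin s)), H₀ ≤ H ∧ LinearIndependent ℝ b ∧
      (∀ y : Fin s → ℝ, 2 * ‖toLp 2 y‖ ≤ ‖∑ i, y i • b i‖) ∧
      (∀ y : Fin s → ℝ, ‖∑ i, y i • b i‖ ≤ (2 * √(s : ℝ) + 2) * ‖toLp 2 y‖) ∧
      (∀ g ∈ H₀, ∃ m : Fin s → ℤ, ∀ v : EuclideanSpace ℝ (Fin s),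
        fstComponentHom g v = v + latVec b m) ∧
      (∀ m : Fin s → ℤ, ∃ g ∈ H₀, ∀ v : EuclideanSpace ℝ (Fin s),
        fstComponentHom g v = v + latVec b m) ∧
      (∀ m : Fin s → ℤ, m ≠ 0 → 2 ≤ ‖latVec b m‖) ∧
      (∀ x : EuclideanSpace ℝ (Fin s), ∃ m : Fin s → ℤ, ‖x - latVec b m‖ ≤ 2 * s) ∧
      (∀ (i₀ : Fin s) (m : Fin s → ℤ), 1 ≤ ‖(1 / 2 : ℝ) • b i₀ - latVec b m‖) := by
  classical
  -- the abelian group `G = Π₁(H)` of isometries of `ℝˢ` with `1`-dense orbit of `0`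
  let G : Subgroup (EuclideanSpace ℝ (Fin s) ≃ᵢ EuclideanSpace ℝ (Fin s)) := H.map fstComponentHom
  have hGcomm : ∀ g ∈ G, ∀ g' ∈ G, g * g' = g' * g := by
    rintro _ ⟨h, hh, rfl⟩ _ ⟨h', hh', rfl⟩
    rw [← map_mul, ← map_mul, hcomm h hh h' hh']
  obtain ⟨y₀⟩ := ‹Nonempty Y›
  have hGD : ∀ x : EuclideanSpace ℝ (Fin s), ∃ g ∈ G, dist (g 0) x ≤ 1 := by
    intro x
    obtain ⟨h, hh, hd⟩ := hcob (toLp 2 (0, y₀)) (toLp 2 (x, y₀))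
    refine ⟨fstComponentHom h, ⟨h, hh, rfl⟩, ?_⟩
    calc dist (fstComponentHom h 0) x
        = dist (h (toLp 2 (0, y₀))).fst
            (toLp 2 (x, y₀) : WithLp 2 (EuclideanSpace ℝ (Fin s) × Y)).fst := by
          rw [fst_apply_toLp_eq_fstComponent h 0 y₀, toLp_fst, fstComponentHom_apply]
      _ ≤ dist (h (toLp 2 (0, y₀))) (toLp 2 (x, y₀)) := dist_fst_le _ _
      _ ≤ 1 := hd
  have htrans : ∀ g ∈ G, ∃ w : EuclideanSpace ℝ (Fin s), ∀ v, g v = v + w := fun g hg ↦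
    exists_eq_add_of_mem_of_comm_of_dense G hGcomm 0 hGD hg
  refine ⟨fun h hh ↦ htrans _ ⟨h, hh, rfl⟩, ?_⟩
  -- the additive group `A` of translation vectors of `G`, with `1`-dense orbit of `0`
  let A : AddSubgroup (EuclideanSpace ℝ (Fin s)) :=
    { carrier := {w | ∃ g ∈ G, ∀ v : EuclideanSpace ℝ (Fin s), g v = v + w}
      zero_mem' := ⟨1, G.one_mem, fun v ↦ by rw [IsometryEquiv.coe_one, id, add_zero]⟩
      add_mem' := by
        rintro w w' ⟨g, hg, hgw⟩ ⟨g', hg', hgw'⟩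
        refine ⟨g * g', G.mul_mem hg hg', fun v ↦ ?_⟩
        rw [IsometryEquiv.mul_apply, hgw', hgw]
        abel
      neg_mem' := by
        rintro w ⟨g, hg, hgw⟩
        refine ⟨g⁻¹, G.inv_mem hg, fun v ↦ ?_⟩
        have h1 := hgw (g⁻¹ v)
        rw [IsometryEquiv.apply_inv_self] at h1
        rw [← sub_eq_add_neg]
        exact eq_sub_of_add_eq h1.symm }
  have hA : ∀ x : EuclideanSpace ℝ (Fin s), ∃ a ∈ A, ‖a - x‖ ≤ 1 := by
    intro x
    obtain ⟨g, hg, hd⟩ := hGD x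
    obtain ⟨w, hw⟩ := htrans g hg
    refine ⟨w, ⟨g, hg, hw⟩, ?_⟩
    have h0 : g 0 = w := by rw [hw, zero_add]
    rwa [← h0, ← dist_eq_norm]
  obtain ⟨b, hbA, hli, hlow, hupp, hsep, hcov, hhalf⟩ := exists_lattice_of_dense_addSubgroup A hA
  -- lifts `γᵢ ∈ H` of the translations by `bᵢ`
  have hlift : ∀ i : Fin s, ∃ h ∈ H, ∀ v : EuclideanSpace ℝ (Fin s),
      fstComponentHom h v = v + b i := by
    intro i
    obtain ⟨g, ⟨h, hh, rfl⟩, hw⟩ := hbA i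
    exact ⟨h, hh, hw⟩
  choose γ hγH hγb using hlift
  let H₀ : Subgroup (WithLp 2 (EuclideanSpace ℝ (Fin s) × Y) ≃ᵢ
      WithLp 2 (EuclideanSpace ℝ (Fin s) × Y)) := Subgroup.closure (Set.range γ)
  have hH₀ : H₀ ≤ H := (Subgroup.closure_le _).mpr (Set.range_subset_iff.mpr hγH)
  -- every element of `H₀` translates `ℝˢ` by a lattice vector
  have hmem : ∀ g ∈ H₀, ∃ m : Fin s → ℤ, ∀ v : EuclideanSpace ℝ (Fin s),
      fstComponentHom g v = v + latVec b m := by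
    intro g hg
    induction hg using Subgroup.closure_induction with
    | mem x hx =>
      obtain ⟨i, rfl⟩ := hx
      exact ⟨Pi.single i 1, fun v ↦ by rw [hγb, latVec_single]⟩
    | one => exact ⟨0, fun v ↦ by rw [map_one, IsometryEquiv.coe_one, id, latVec_zero, add_zero]⟩
    | mul x y _ _ hx hy =>
      obtain ⟨m, hm⟩ := hx
      obtain ⟨m', hm'⟩ := hy
      refine ⟨m + m', fun v ↦ ?_⟩
      rw [map_mul, IsometryEquiv.mul_apply, hm', hm, latVec_add]
      abel
    | inv x _ hx =>
      obtain ⟨m, hm⟩ := hx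
      refine ⟨-m, fun v ↦ ?_⟩
      have h1 := hm (fstComponentHom x⁻¹ v)
      rw [← IsometryEquiv.mul_apply, ← map_mul, mul_inv_cancel, map_one, IsometryEquiv.coe_one,
        id] at h1
      rw [latVec_neg, ← sub_eq_add_neg]
      exact eq_sub_of_add_eq h1.symm
  -- every lattice vector is realised by `H₀`
  have hreal : ∀ m : Fin s → ℤ, ∃ g ∈ H₀, ∀ v : EuclideanSpace ℝ (Fin s),
      fstComponentHom g v = v + latVec b m := by
    intro m
    have hsingle : ∀ (i : Fin s) (k : ℤ), Pi.single i k ∈ realizedCoeffs H₀ b := by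
      intro i k
      have h1 : Pi.single i (1 : ℤ) ∈ realizedCoeffs H₀ b :=
        ⟨γ i, Subgroup.subset_closure ⟨i, rfl⟩, fun v ↦ by rw [hγb, latVec_single]⟩
      have h2 : (Pi.single i k : Fin s → ℤ) = k • (Pi.single i (1 : ℤ) : Fin s → ℤ) := by
        ext j
        simp [Pi.single_apply]
      rw [h2]
      exact AddSubgroup.zsmul_mem _ h1 k
    exact Pi.single_induction (p := (· ∈ realizedCoeffs H₀ b)) m (AddSubgroup.zero_mem _)
      (fun f g hf hg ↦ AddSubgroup.add_mem _ hf hg) hsingle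
  exact ⟨H₀, b, hH₀, hli, hlow, hupp, hmem, hreal, hsep, hcov, hhalf⟩

/-! #### Consequences for `Tˢ = ℝˢ/Π₁(H₀)` and `X̄ = (ℝˢ ×₂ Ŷ)/H₀` -/

/-- `X̄` HAS BOUNDED DIAMETER: `diam X̄ ≤ √((2s)² + D²)` for `X̄ = (ℝˢ ×₂ Ŷ)/H₀` whenever `Π₁(H₀)`
realises all the vectors of a lattice of covering radius `≤ 2s` and `diam Ŷ ≤ D` (p. 13: "It is easy
to check `diam(X̄) ≤ √(D² + (4n)²)`"). Proof: move `x'` by the element of `H₀` translating `ℝˢ` by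
the lattice vector nearest to `x₁ - x₁'`; Pythagoras. [cite: HuangHuangWangZhu2026, §4 p. 13] -/
theorem xbar_dist_le
    (H₀ : Subgroup (WithLp 2 (EuclideanSpace ℝ (Fin s) × Y) ≃ᵢ
      WithLp 2 (EuclideanSpace ℝ (Fin s) × Y)))
    {b : Fin s → EuclideanSpace ℝ (Fin s)}
    (hreal : ∀ m : Fin s → ℤ, ∃ g ∈ H₀, ∀ v : EuclideanSpace ℝ (Fin s),
      fstComponentHom g v = v + latVec b m)
    (hcov : ∀ x : EuclideanSpace ℝ (Fin s), ∃ m : Fin s → ℤ, ‖x - latVec b m‖ ≤ 2 * s)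
    {D : ℝ} (hD : ∀ y y' : Y, dist y y' ≤ D) (x x' : WithLp 2 (EuclideanSpace ℝ (Fin s) × Y)) :
    dist (⟦x⟧ : MulAction.orbitRel.Quotient H₀ (WithLp 2 (EuclideanSpace ℝ (Fin s) × Y))) ⟦x'⟧ ≤
      √((2 * s) ^ 2 + D ^ 2) := by
  obtain ⟨m, hm⟩ := hcov (x.fst - x'.fst)
  obtain ⟨g, hg, hgm⟩ := hreal m
  have h1 : dist (⟦x⟧ : MulAction.orbitRel.Quotient H₀ (WithLp 2 (EuclideanSpace ℝ (Fin s) × Y)))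
      ⟦x'⟧ ≤ dist x ((⟨g, hg⟩ : H₀) • x') := dist_mk_mk_le_dist_smul (G := H₀) x x' ⟨g, hg⟩
  refine h1.trans ?_
  rw [Subgroup.smul_def_isometryEquiv, Subgroup.coe_mk, apply_eq_toLp g x']
  have hA : dist x.fst (fstComponent g x'.fst) ≤ 2 * s := by
    rw [← fstComponentHom_apply, hgm, dist_eq_norm, sub_add_eq_sub_sub]
    exact hm
  have hB : dist x.snd (sndComponent g x'.snd) ≤ D := hD _ _
  have hsq : dist x (toLp 2 (fstComponent g x'.fst, sndComponent g x'.snd)) ^ 2 =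
      dist x.fst (fstComponent g x'.fst) ^ 2 + dist x.snd (sndComponent g x'.snd) ^ 2 :=
    prodL2_dist_sq x (toLp 2 (fstComponent g x'.fst, sndComponent g x'.snd))
  have h3 : dist x (toLp 2 (fstComponent g x'.fst, sndComponent g x'.snd)) ^ 2 ≤
      (2 * s) ^ 2 + D ^ 2 := by
    rw [hsq]
    exact add_le_add (pow_le_pow_left₀ dist_nonneg hA 2) (pow_le_pow_left₀ dist_nonneg hB 2)
  calc dist x (toLp 2 (fstComponent g x'.fst, sndComponent g x'.snd))
      = √(dist x (toLp 2 (fstComponent g x'.fst, sndComponent g x'.snd)) ^ 2) :=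
        (Real.sqrt_sq dist_nonneg).symm
    _ ≤ √((2 * s) ^ 2 + D ^ 2) := Real.sqrt_le_sqrt h3

/-- THE TORUS `Tˢ = ℝˢ/Π₁(H₀)` AND THE SUBMETRY `F : X̄ → Tˢ` (Huang–Huang–Wang–Zhu 2026, §4 p. 13),
assembled: for the lattice subgroup `H₀ ≤ H` of `exists_latticeSubgroup`, acting on `ℝˢ` through
`Π₁` (`Literature.Geometry.MetricGeometry.mulActionFst`), the orbit space `Tˢ = ℝˢ/H₀` satisfies
`inj ≥ 1` (the orbit map is isometric on pairs at distance `≤ 1`), `diam Tˢ ≤ 2s`, `diam Tˢ ≥ 1`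
(when `s ≥ 1`), `diam X̄ ≤ √((2s)² + D²)` for `X̄ = (ℝˢ ×₂ Ŷ)/H₀` and `D ≥ diam Ŷ`, and the map
`F : X̄ → Tˢ` induced by the first projection is a submetry (at every scale, in particular at scale
`1/4`). [cite: HuangHuangWangZhu2026, §4 p. 13] -/
theorem torusPackage
    (H : Subgroup (WithLp 2 (EuclideanSpace ℝ (Fin s) × Y) ≃ᵢ
      WithLp 2 (EuclideanSpace ℝ (Fin s) × Y)))
    (hcomm : ∀ g ∈ H, ∀ h ∈ H, g * h = h * g)
    (hcob : ∀ x x' : WithLp 2 (EuclideanSpace ℝ (Fin s) × Y), ∃ h ∈ H, dist (h x) x' ≤ 1)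
    {D : ℝ} (hD : ∀ y y' : Y, dist y y' ≤ D) :
    ∃ H₀ : Subgroup (WithLp 2 (EuclideanSpace ℝ (Fin s) × Y) ≃ᵢ
        WithLp 2 (EuclideanSpace ℝ (Fin s) × Y)), H₀ ≤ H ∧
      (∀ a a' : EuclideanSpace ℝ (Fin s), dist a a' ≤ 1 →
        dist (⟦a⟧ : MulAction.orbitRel.Quotient H₀ (EuclideanSpace ℝ (Fin s))) ⟦a'⟧ = dist a a') ∧
      (∀ a a' : EuclideanSpace ℝ (Fin s),
        dist (⟦a⟧ : MulAction.orbitRel.Quotient H₀ (EuclideanSpace ℝ (Fin s))) ⟦a'⟧ ≤ 2 * s) ∧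
      (∀ _ : 1 ≤ s, ∃ a a' : EuclideanSpace ℝ (Fin s),
        1 ≤ dist (⟦a⟧ : MulAction.orbitRel.Quotient H₀ (EuclideanSpace ℝ (Fin s))) ⟦a'⟧) ∧
      (∀ x x' : WithLp 2 (EuclideanSpace ℝ (Fin s) × Y),
        dist (⟦x⟧ : MulAction.orbitRel.Quotient H₀ (WithLp 2 (EuclideanSpace ℝ (Fin s) × Y))) ⟦x'⟧ ≤
          √((2 * s) ^ 2 + D ^ 2)) ∧
      IsSubmetry (orbitQuotientMap (G := H₀)
        (WithLp.fst : WithLp 2 (EuclideanSpace ℝ (Fin s) × Y) → EuclideanSpace ℝ (Fin s))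
        (fst_smul H₀)) := by
  obtain ⟨-, H₀, b, hH₀, -, -, -, hmem, hreal, hsep, hcov, hhalf⟩ :=
    exists_latticeSubgroup H hcomm hcob
  have hmem' : ∀ γ : H₀, ∃ m : Fin s → ℤ, ∀ v : EuclideanSpace ℝ (Fin s),
      γ • v = v + latVec b m := fun γ ↦ by
    obtain ⟨m, hm⟩ := hmem γ γ.2
    exact ⟨m, fun v ↦ by rw [subgroup_smul_fst_def, hm]⟩
  have hreal' : ∀ m : Fin s → ℤ, ∃ γ : H₀, ∀ v : EuclideanSpace ℝ (Fin s),
      γ • v = v + latVec b m := fun m ↦ by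
    obtain ⟨g, hg, hgm⟩ := hreal m
    exact ⟨⟨g, hg⟩, fun v ↦ by rw [subgroup_smul_fst_def, Subgroup.coe_mk, hgm]⟩
  refine ⟨H₀, hH₀, fun a a' h ↦ torus_dist_eq_of_dist_le_one hmem' hsep h,
    fun a a' ↦ torus_dist_le hreal' hcov a a', fun hs ↦ ?_,
    fun x x' ↦ xbar_dist_le H₀ hreal hcov hD x x', isSubmetry_orbitQuotientMap_fst H₀⟩
  exact ⟨(1 / 2 : ℝ) • b ⟨0, hs⟩, 0, one_le_torus_dist hmem' hhalf ⟨0, hs⟩⟩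

end TorusPackage

end Literature.Geometry.Riemannian
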